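import Mathlib
import HarnessLib

/-!
# Reduction modulo a degree-one prime is injective on elements of small norm

Topic `Literature/NumberTheory/NumberFields`.  Let `K` be a number field and `φ : 𝓞_K → ℤ/p` a
surjective ring homomorphism (the reduction modulo a prime ideal of norm `p`).  If `φ(x) = 0` then
`p ∣ N_{K/ℚ}(x)`, because `x` lies in the kernel, an ideal of absolute norm `p`; hence an element
with `|N(x)| < p` and `φ(x) = 0` must vanish.  This "no wrap-around" principle is the one place
where the number field enters quantitatively in the lifts of square-difference-free sets to
induced point–line matchings over `𝔽_p` (Hunter–Pohoata–Verstraëte–Zhang, arXiv:2601.19879,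
Prop. 2.3 over `ℤ`; C. Pohoata, arXiv:2607.20422 (2026), Proposition 5.1 over totally real `K`).

* `natAbs_norm_dvd_of_map_eq_zero` — `φ` surjective onto `ZMod p`, `φ x = 0` ⇒ `p ∣ |N(x)|`;
* `eq_zero_of_map_eq_zero_of_natAbs_norm_lt` — … and `|N(x)| < p` ⇒ `x = 0`.

Mathlib ingredients: `Ideal.absNorm` (`= ` cardinality of the quotient), `Ideal.absNorm_span_singleton`,
`Ideal.absNorm_dvd_absNorm_of_le`, `Algebra.norm_eq_zero_iff`.  No definitions.

## References
* C. Pohoata, arXiv:2607.20422 (2026), Proposition 5.1 (proof). [Pohoata2026SharpExponentMinimalDistance]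
-/

namespace Literature.NumberTheory.NumberFields

open NumberField

variable {K : Type*} [Field K] [NumberField K]

/-- If `φ : 𝓞_K →+* ZMod p` is surjective and `φ x = 0`, then `p` divides `|N_{K/ℚ}(x)|`: the kernel
of `φ` is an ideal of absolute norm `p` containing `x`.
[cite: Pohoata2026SharpExponentMinimalDistance, Proposition 5.1 (proof)] -/
theorem natAbs_norm_dvd_of_map_eq_zero {p : ℕ} (φ : 𝓞 K →+* ZMod p)
    (hφ : Function.Surjective φ) {x : 𝓞 K} (hx : φ x = 0) :
    p ∣ (Algebra.norm ℤ x).natAbs := by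
  classical
  set I : Ideal (𝓞 K) := RingHom.ker φ with hI
  have hxI : x ∈ I := (RingHom.mem_ker).mpr hx
  -- `absNorm I = p`
  have hcard : Ideal.absNorm I = p := by
    rw [Ideal.absNorm_apply, Submodule.cardQuot_apply, hI]
    have e : (𝓞 K ⧸ RingHom.ker φ) ≃+* ZMod p := RingHom.quotientKerEquivOfSurjective hφ
    rw [Nat.card_congr e.toEquiv, Nat.card_zmod]
  -- `absNorm I ∣ absNorm (span {x}) = |N x|`
  have hdvd : Ideal.absNorm I ∣ Ideal.absNorm (Ideal.span {x}) :=
    Ideal.absNorm_dvd_absNorm_of_le ((Ideal.span_singleton_le_iff_mem I).mpr hxI)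
  rwa [hcard, Ideal.absNorm_span_singleton] at hdvd

/-- **No wrap-around.**  If `φ : 𝓞_K →+* ZMod p` is surjective, `φ x = 0` and `|N_{K/ℚ}(x)| < p`,
then `x = 0`. [cite: Pohoata2026SharpExponentMinimalDistance, Proposition 5.1 (proof)] -/
theorem eq_zero_of_map_eq_zero_of_natAbs_norm_lt {p : ℕ} (φ : 𝓞 K →+* ZMod p)
    (hφ : Function.Surjective φ) {x : 𝓞 K} (hx : φ x = 0)
    (hlt : (Algebra.norm ℤ x).natAbs < p) : x = 0 := by
  have hdvd := natAbs_norm_dvd_of_map_eq_zero φ hφ hx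
  have h0 : (Algebra.norm ℤ x).natAbs = 0 := Nat.eq_zero_of_dvd_of_lt hdvd hlt
  exact Algebra.norm_eq_zero_iff.mp (Int.natAbs_eq_zero.mp h0)

end Literature.NumberTheory.NumberFields
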